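import Summits.ResolutionOfSingularities.KangarooAtlas.MizutaniDiffDuality
import Summits.ResolutionOfSingularities.KangarooAtlas.MizutaniFrobTensor
import Literature.AlgebraicGeometry.Resolution.HironakaGroupSchemeExponent
import Mathlib.LinearAlgebra.Dimension.Free
import HarnessLib

/-!
# Mizutani's conjecture `m(e) = 2p^e − 1` — invariant additive forms as tensors in `J^q`

Cell topic `Summits/ResolutionOfSingularities/KangarooAtlas` (pub-rosobs); namespace
`Summit.ResolutionOfSingularities.KangarooAtlas.Mizutani`.  Part of the Lean transcription of the
in-house note MIZUTANI-PROOF-g59 (AI-written, AI-audited; *AI review is weaker than expert review*; not a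
resolution theorem).  §3 DICTIONARY, step (C): Oda's invariant additive forms
`invForms k p 𝔭 e = (L_B)_e` (`Literature/…/HironakaGroupScheme.lean`, Oda 1983-II p. 1168) read in the
tensor square `k ⊗_K k`, `K = k^{p^e}`.

Fix a homogeneous ideal `𝔭 ⊂ S = k[X_0..X_n]`, `A = S/𝔭`, `ξ_i` the classes of the variables, `q = p^e`.
Choose a `k`-basis `(m_j)_{j < d}` of `M_e = span_k{ξ_i^q} ⊂ A` and write `ξ_i^q = Σ_j c_{ij} m_j`
(`coord`).  For a coefficient vector `a ∈ k^{n+1}` put `rho j a := Σ_i a_i ⊗ c_{ij} ∈ k ⊗_K k`.  Then: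

* `mk_addForm` — the additive form `Σ_i g_i X_i^q` maps to `Σ_j (Σ_i g_i c_{ij}) m_j` in `A`, so it lies in
  `𝔭` iff all `Σ_i g_i c_{ij} = 0` (`addForm_mem_iff`), and `dPair D (rho j a) = Σ_i D(a_i) c_{ij}`;
* **`mem_invForms_iff_rho`** — `a ∈ (L_B)_e ⟺ rho j a ∈ J^q for all j` (duality `MizutaniDiffDuality`):
  the note's `N = J^q ∩ (k' ⊗ H)` (§3 Prop. 3.1) for Oda's definition;
* **`frobVec_one_mem_invForms`** — `F (L_B)_e ⊆ (L_B)_{e+1}` (`L_B` is a `k[F]`-submodule; via the Frobenius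
  of the tensor square, `MizutaniFrobTensor`), hence `span_k F(L_B)_e ⊆ (L_B)_{e+1}`;
* **`exists_mem_invForms_not_mem_span`** — if `exponent ≤ e+1` but `¬ exponent ≤ e` then some
  `a ∈ (L_B)_{e+1}` is not in `span_k F((L_B)_e)` (the EXACT exponent produces a new form).

References: [Oda1983HironakaGroupSchemeII] §2 (p. 1168), Lemma 2.1, Thm. 3.1 (p. 1173);
[Mizutani1973HironakaGroupSchemes] §1 (c), Thm. 1.3; in-house note §3 (a)–(e).
-/

open MvPolynomial TensorProduct Literature.AlgebraicGeometry.Resolution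
  Literature.AlgebraicGeometry.Resolution.HironakaScheme

namespace Summit.ResolutionOfSingularities.KangarooAtlas.Mizutani

universe u

section Coordinates

variable (k : Type u) [Field k] (p : ℕ) [Fact p.Prime] [CharP k p] {n : ℕ}
  (𝔭 : Ideal (MvPolynomial (Fin (n + 1)) k)) (e : ℕ)

/-- The class `ξ_i` of the variable `X_i` in `A = S/𝔭`. [cite: Oda1983HironakaGroupSchemeII, Thm. 3.1 (p. 1173: ψ : L_0 → E, y ↦ the image of 1 ⊗ y)] -/
noncomputable def xi (i : Fin (n + 1)) : MvPolynomial (Fin (n + 1)) k ⧸ 𝔭 := Ideal.Quotient.mk 𝔭 (X i)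

/-- `M_e = span_k {ξ_i^{p^e}} ⊂ A` (finite-dimensional). [cite: Oda1983HironakaGroupSchemeII, Thm. 3.1 (p. 1173: the finite-dimensional E)] -/
noncomputable def powSpan : Submodule k (MvPolynomial (Fin (n + 1)) k ⧸ 𝔭) :=
  Submodule.span k (Set.range fun i : Fin (n + 1) => xi k 𝔭 i ^ p ^ e)

/-- `M_e` is finite-dimensional. [folklore] -/
instance powSpan_finite : FiniteDimensional k (powSpan k p 𝔭 e) :=
  FiniteDimensional.span_of_finite k (Set.finite_range _)

/-- `d = dim_k M_e`. [folklore] -/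
noncomputable def cdim : ℕ := Module.finrank k (powSpan k p 𝔭 e)

/-- A `k`-basis `(m_j)` of `M_e`. [folklore] -/
noncomputable def cbasis : Module.Basis (Fin (cdim k p 𝔭 e)) k (powSpan k p 𝔭 e) := Module.finBasis k _

/-- `ξ_i^{p^e}` as an element of `M_e`. [folklore] -/
noncomputable def xiPow (i : Fin (n + 1)) : powSpan k p 𝔭 e :=
  ⟨xi k 𝔭 i ^ p ^ e, Submodule.subset_span ⟨i, rfl⟩⟩

/-- The coordinates `c_{ij}`: `ξ_i^{p^e} = Σ_j c_{ij} m_j`. [cite: Oda1983HironakaGroupSchemeII, Thm. 3.1 (p. 1173: coordinates of φ in an E_0-basis; in-house note §3 (a))] -/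
noncomputable def coord (i : Fin (n + 1)) (j : Fin (cdim k p 𝔭 e)) : k := (cbasis k p 𝔭 e).repr (xiPow k p 𝔭 e i) j

omit [Fact p.Prime] [CharP k p] in
/-- `ξ_i^{p^e} = Σ_j c_{ij} m_j` in `A`. [folklore] -/
theorem xi_pow_eq_sum (i : Fin (n + 1)) :
    xi k 𝔭 i ^ p ^ e = ∑ j, coord k p 𝔭 e i j • ((cbasis k p 𝔭 e j : powSpan k p 𝔭 e) : MvPolynomial (Fin (n + 1)) k ⧸ 𝔭) := by
  have h := (cbasis k p 𝔭 e).sum_repr (xiPow k p 𝔭 e i)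
  have h' := congrArg (fun z : powSpan k p 𝔭 e => (z : MvPolynomial (Fin (n + 1)) k ⧸ 𝔭)) h
  simp only [Submodule.coe_sum, Submodule.coe_smul] at h'
  change ((xiPow k p 𝔭 e i : powSpan k p 𝔭 e) : MvPolynomial (Fin (n + 1)) k ⧸ 𝔭) = _
  rw [← h']
  rfl

omit [Fact p.Prime] [CharP k p] in
/-- The basis vectors `m_j`, read in `A`, are `k`-linearly independent. [folklore] -/
theorem cbasis_linearIndependent :
    LinearIndependent k fun j => ((cbasis k p 𝔭 e j : powSpan k p 𝔭 e) : MvPolynomial (Fin (n + 1)) k ⧸ 𝔭) :=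
  (cbasis k p 𝔭 e).linearIndependent.map' (powSpan k p 𝔭 e).subtype (Submodule.ker_subtype _)

omit [Fact p.Prime] [CharP k p] in
/-- **The additive form `Σ_i g_i X_i^{p^e}` in `A`**: `Σ_j (Σ_i g_i c_{ij}) m_j`. [cite: Oda1983HironakaGroupSchemeII, §2 (p. 1168: L_e ≅ k ⊗ F^e(L_0))] -/
theorem mk_addForm (g : Fin (n + 1) → k) :
    Ideal.Quotient.mk 𝔭 (addForm k p e g) =
      ∑ j, (∑ i, g i * coord k p 𝔭 e i j) •
        ((cbasis k p 𝔭 e j : powSpan k p 𝔭 e) : MvPolynomial (Fin (n + 1)) k ⧸ 𝔭) := by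
  unfold addForm
  rw [map_sum]
  have hterm : ∀ i, Ideal.Quotient.mk 𝔭 (C (g i) * X i ^ p ^ e) = g i • xi k 𝔭 i ^ p ^ e := by
    intro i
    rw [map_mul, map_pow]
    exact (Algebra.smul_def (g i) (xi k 𝔭 i ^ p ^ e)).symm
  simp_rw [hterm, xi_pow_eq_sum, Finset.smul_sum, smul_smul]
  rw [Finset.sum_comm]
  refine Finset.sum_congr rfl fun j _ => ?_
  rw [Finset.sum_smul]

omit [Fact p.Prime] [CharP k p] in
/-- **`Σ_i g_i X_i^{p^e} ∈ 𝔭 ⟺ Σ_i g_i c_{ij} = 0` for all `j`.** [cite: Oda1983HironakaGroupSchemeII, Lemma 2.1 (p. 1169: Q = 𝔭 ∩ L and U)] -/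
theorem addForm_mem_iff (g : Fin (n + 1) → k) :
    addForm k p e g ∈ 𝔭 ↔ ∀ j, ∑ i, g i * coord k p 𝔭 e i j = 0 := by
  rw [← Ideal.Quotient.eq_zero_iff_mem, mk_addForm]
  constructor
  · intro h j
    exact Fintype.linearIndependent_iff.mp (cbasis_linearIndependent k p 𝔭 e) _ h j
  · intro h
    exact Finset.sum_eq_zero fun j _ => by rw [h j, zero_smul]

/-- **`rho j a = Σ_i a_i ⊗ c_{ij} ∈ k ⊗_K k`**, `K = k^{p^e}` (left coefficients `a`), `k`-linear in `a`.
[cite: Oda1983HironakaGroupSchemeII, Thm. 3.1 (p. 1173: (1 ⊗ φ)(v)); in-house note §3 (a) N(H_i)] -/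
noncomputable def rho (j : Fin (cdim k p 𝔭 e)) : (Fin (n + 1) → k) →ₗ[k] k ⊗[frobPow k p e] k where
  toFun a := ∑ i, a i ⊗ₜ[frobPow k p e] coord k p 𝔭 e i j
  map_add' a b := by
    rw [← Finset.sum_add_distrib]
    exact Finset.sum_congr rfl fun i _ => by rw [Pi.add_apply, TensorProduct.add_tmul]
  map_smul' c a := by
    rw [RingHom.id_apply, Finset.smul_sum]
    exact Finset.sum_congr rfl fun i _ => by rw [Pi.smul_apply, TensorProduct.smul_tmul']

/-- `rho j a` unfolded. [folklore] -/
theorem rho_apply (j : Fin (cdim k p 𝔭 e)) (a : Fin (n + 1) → k) :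
    rho k p 𝔭 e j a = ∑ i, a i ⊗ₜ[frobPow k p e] coord k p 𝔭 e i j := rfl

/-- `dPair D (rho j a) = Σ_i D(a_i) c_{ij}`. [folklore] -/
theorem dPair_rho (D : k →ₗ[frobPow k p e] k) (j : Fin (cdim k p 𝔭 e)) (a : Fin (n + 1) → k) :
    dPair (frobPow k p e) (AlgHom.id (frobPow k p e) k) D (rho k p 𝔭 e j a) = ∑ i, D (a i) * coord k p 𝔭 e i j := by
  rw [rho_apply, map_sum]
  exact Finset.sum_congr rfl fun i _ => by rw [dPair_tmul, AlgHom.id_apply]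

/-- Membership in `invForms`, unfolded (Oda's printed description taken as definition).
[cite: Oda1983HironakaGroupSchemeII, §2 (p. 1168)] -/
theorem mem_invForms_iff (a : Fin (n + 1) → k) :
    a ∈ invForms k p 𝔭 e ↔ ∀ D : k →ₗ[frobPow k p e] k, IsDiffOpLE (frobPow k p e) (p ^ e - 1) D →
      addForm k p e (fun j => D (a j)) ∈ 𝔭 :=
  Iff.rfl

/-- `p^e = (p^e − 1) + 1`. [folklore] -/
theorem pow_eq_sub_one_add_one : p ^ e = (p ^ e - 1) + 1 :=
  (Nat.sub_add_cancel (Nat.one_le_pow _ _ (Fact.out : p.Prime).pos)).symm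

/-- **Invariant additive forms as tensors**: `a ∈ (L_B)_e ⟺ rho j a ∈ J^{p^e}` for every `j`, where
`J = ker(k ⊗_K k → k)`, `K = k^{p^e}`.  (The note's `N = J^q ∩ (k' ⊗ H)`; Oda's `V = 𝒟^{(1)}(U)`.)
[cite: Oda1983HironakaGroupSchemeII, Cor. 2.3 (p. 1171: V = 𝒟'(U)) and Thm. 3.1; in-house note §3 (a)] -/
theorem mem_invForms_iff_rho (a : Fin (n + 1) → k) :
    a ∈ invForms k p 𝔭 e ↔
      ∀ j, rho k p 𝔭 e j a ∈ KaehlerDifferential.ideal (frobPow k p e) k ^ p ^ e := by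
  rw [mem_invForms_iff, pow_eq_sub_one_add_one p e, Nat.add_sub_cancel]
  constructor
  · intro ha j
    rw [mem_ideal_pow_iff_forall_dPair]
    intro D hD
    rw [dPair_rho]
    exact (addForm_mem_iff k p 𝔭 e _).mp (ha D hD) j
  · intro h D hD
    rw [addForm_mem_iff]
    intro j
    rw [← dPair_rho]
    exact (mem_ideal_pow_iff_forall_dPair (frobPow k p e) _ _).mp (h j) D hD

end Coordinates

/-! ## `F`-stability and the exact exponent -/

section Frobenius

variable (k : Type u) [Field k] (p : ℕ) [Fact p.Prime] [CharP k p] {n : ℕ}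
  (𝔭 : Ideal (MvPolynomial (Fin (n + 1)) k))

omit [Fact p.Prime] [CharP k p] in
/-- `frobVec 1 a = (a_i^p)`. [folklore] -/
theorem frobVec_one_apply (a : Fin (n + 1) → k) (i : Fin (n + 1)) : frobVec k p 1 a i = a i ^ p := by
  rw [frobVec, pow_one]

omit [Fact p.Prime] [CharP k p] in
/-- `frobVec 0 = id`. [folklore] -/
theorem frobVec_zero (a : Fin (n + 1) → k) : frobVec k p 0 a = a := by
  funext i; rw [frobVec, pow_zero, pow_one]

/-- **`F (L_B)_e ⊆ (L_B)_{e+1}`**: the invariant additive forms are stable under the `p`-th power map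
(`L_B` is a graded `k[F]`-submodule of `L`).  Proof through the tensor square: `(F ⊗ F)(rho_e j a) ∈ J^{p^{e+1}}`
and `Σ_i D(a_i^p) ξ_i^{p^{e+1}} = Σ_j dPair D ((F⊗F) rho_e j a) · m_j^p`.
[cite: Oda1983HironakaGroupSchemeII, §2 (p. 1168: L_B a graded k[F]-submodule of L)] -/
theorem frobVec_one_mem_invForms (h𝔭 : 𝔭 ≠ ⊤) {e : ℕ} {a : Fin (n + 1) → k} (ha : a ∈ invForms k p 𝔭 e) :
    frobVec k p 1 a ∈ invForms k p 𝔭 (e + 1) := by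
  classical
  set A := MvPolynomial (Fin (n + 1)) k ⧸ 𝔭
  haveI : Nontrivial A := Ideal.Quotient.nontrivial_iff.mpr h𝔭
  haveI : CharP A p := charP_of_injective_algebraMap (algebraMap k A).injective p
  have hK : ∀ c : k, c ∈ frobPow k p e → c ^ p ∈ frobPow k p (e + 1) := fun c hc => pow_mem_frobPow_succ hc
  rw [mem_invForms_iff]
  intro D hD
  rw [← Ideal.Quotient.eq_zero_iff_mem]
  -- expand the additive form of level `e + 1` along the level-`e` basis raised to the `p`-th power
  have hexp : Ideal.Quotient.mk 𝔭 (addForm k p (e + 1) fun j => D (frobVec k p 1 a j)) =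
      ∑ j, (∑ i, D (a i ^ p) * coord k p 𝔭 e i j ^ p) •
        (((cbasis k p 𝔭 e j : powSpan k p 𝔭 e) : A) ^ p) := by
    unfold addForm
    rw [map_sum]
    have hterm : ∀ i, Ideal.Quotient.mk 𝔭 (C (D (frobVec k p 1 a i)) * X i ^ p ^ (e + 1)) =
        D (a i ^ p) • (xi k 𝔭 i ^ p ^ e) ^ p := by
      intro i
      rw [map_mul, map_pow, frobVec_one_apply, ← pow_mul, ← pow_succ]
      exact (Algebra.smul_def (D (a i ^ p)) (xi k 𝔭 i ^ p ^ (e + 1))).symm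
    simp_rw [hterm, xi_pow_eq_sum, sum_pow_char, smul_pow, Finset.smul_sum, smul_smul]
    rw [Finset.sum_comm]
    refine Finset.sum_congr rfl fun j _ => ?_
    rw [Finset.sum_smul]
  rw [hexp]
  refine Finset.sum_eq_zero fun j _ => ?_
  -- the coefficient is the pairing of `D` with `(F ⊗ F)(rho_e j a) ∈ J^{p^{e+1}}`
  have hcoef : (∑ i, D (a i ^ p) * coord k p 𝔭 e i j ^ p) =
      dPair (frobPow k p (e + 1)) (AlgHom.id (frobPow k p (e + 1)) k) D
        (frobTensor (frobPow k p e) (frobPow k p (e + 1)) hK (rho k p 𝔭 e j a)) := by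
    rw [rho_apply, frobTensor_sum_tmul, map_sum]
    exact Finset.sum_congr rfl fun i _ => by rw [dPair_tmul, AlgHom.id_apply]
  have hmem : frobTensor (frobPow k p e) (frobPow k p (e + 1)) hK (rho k p 𝔭 e j a) ∈
      KaehlerDifferential.ideal (frobPow k p (e + 1)) k ^ ((p ^ (e + 1) - 1) + 1) := by
    rw [← pow_eq_sub_one_add_one p (e + 1), pow_succ']
    exact frobTensor_mem_ideal_pow _ _ hK ((mem_invForms_iff_rho k p 𝔭 e a).mp ha j)
  rw [hcoef, (isDiffOpLE_iff_dPair (frobPow k p (e + 1)) _ D).mp hD _ hmem, zero_smul]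

/-- `span_k F((L_B)_e) ⊆ (L_B)_{e+1}`. [cite: Oda1983HironakaGroupSchemeII, §2 (p. 1168: kF Q_e ⊆ Q_{e+1})] -/
theorem span_frobVec_image_le (h𝔭 : 𝔭 ≠ ⊤) (e : ℕ) :
    Submodule.span k (frobVec k p 1 '' (invForms k p 𝔭 e : Set (Fin (n + 1) → k))) ≤ invForms k p 𝔭 (e + 1) := by
  rw [Submodule.span_le]
  rintro _ ⟨a, ha, rfl⟩
  exact frobVec_one_mem_invForms k p 𝔭 h𝔭 ha

/-- If `exponent ≤ e + 1` and `(L_B)_{e+1} = k·F (L_B)_e` then `exponent ≤ e`.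
[cite: Oda1983HironakaGroupSchemeII, §2 (p. 1168: exponent(Q) ≤ e iff kF^{j−e}Q_e = Q_j for all j ≥ e)] -/
theorem exponentLE_of_succ_eq {e : ℕ} (hE : ExponentLE k p 𝔭 (e + 1))
    (heq : invForms k p 𝔭 (e + 1) =
      Submodule.span k (frobVec k p 1 '' (invForms k p 𝔭 e : Set (Fin (n + 1) → k)))) :
    ExponentLE k p 𝔭 e := by
  intro j hj
  rcases Nat.eq_or_lt_of_le hj with rfl | hlt
  · rw [Nat.sub_self]
    have : frobVec k p 0 '' (invForms k p 𝔭 e : Set (Fin (n + 1) → k)) = invForms k p 𝔭 e := by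
      have hid : frobVec k p 0 = (id : (Fin (n + 1) → k) → (Fin (n + 1) → k)) := funext (frobVec_zero k p)
      rw [hid, Set.image_id]
    rw [this, Submodule.span_eq]
  · rw [hE j hlt, heq, span_image_frobVec_span, Set.image_image]
    congr 1
    refine Set.image_congr' fun v => ?_
    rw [frobVec_frobVec]
    congr 1
    omega

/-- **The exact exponent produces a new invariant form**: if `exponent(B(𝔭)) ≤ e + 1` but
`¬ exponent(B(𝔭)) ≤ e`, some `a ∈ (L_B)_{e+1}` is NOT a `k`-combination of `p`-th powers of forms of
`(L_B)_e` (in-house note §3 (b): "V not defined over F^{−(e−1)} forces some N(H_i) not defined over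
F^{−(e−1)}"). [cite: Oda1983HironakaGroupSchemeII, Cor. 2.3 (p. 1171: exponent(B) ≤ e iff V is defined over F^{-e}(k))] -/
theorem exists_mem_invForms_not_mem_span (h𝔭 : 𝔭 ≠ ⊤) {e : ℕ} (hE : ExponentLE k p 𝔭 (e + 1))
    (hne : ¬ ExponentLE k p 𝔭 e) :
    ∃ a ∈ invForms k p 𝔭 (e + 1),
      a ∉ Submodule.span k (frobVec k p 1 '' (invForms k p 𝔭 e : Set (Fin (n + 1) → k))) := by
  by_contra h
  push Not at h
  exact hne (exponentLE_of_succ_eq k p 𝔭 hE (le_antisymm h (span_frobVec_image_le k p 𝔭 h𝔭 e)))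

end Frobenius

end Summit.ResolutionOfSingularities.KangarooAtlas.Mizutani
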